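import Literature.Computability.AlgebraicComplexity.LinSubst
import Literature.Computability.AlgebraicComplexity.StandardFamilies

/-!
# `ToricFixedPoints` / line `form_then_lift`, stub F1 at `(3,3)`: five of the six content classes
lie in `End(ℂ⁹)·det₃` identically (hence are toric by `FormDeborderingEndType`)

Disproof.lean §6d lists the `T⁵`-weight (= `H₀(3,3)`-semi-invariant, see
`FormDeborderingMargins33`) cubics on the `3 × 3` variables as six content classes, up to
`S₃ × S₃ ⋊ ℤ/2`: `x₁₁³`, `x₁₁²x₁₂`, `x₁₁x₁₂x₁₃`, `⟨x₁₁²x₂₂, x₁₁x₁₂x₂₁⟩`,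
`⟨x₁₁x₁₂x₂₃, x₁₁x₁₃x₂₂, x₁₂x₁₃x₂₁⟩` and the permutation-monomial family `F_c = Σ_σ c_σ x_σ`, and
states that the first five are in `End(ℂ⁹)·det₃` identically (explicit `3 × 3` determinants).  This
file puts those five identities in the kernel (0-indexed variables `X (i,j)`):

* `det_smul_X_mem_endOrbit` — generic: the determinant of any square matrix whose entries are scalar
  multiples of single variables, `N i j = s i j • X (v i j)`, is in `endOrbit det` (substitution
  matrix `A k (i,j) = [k = v i j] s i j`);
* `contentClass₁_mem_endOrbit` … `contentClass₅_mem_endOrbit` — every member of each of the five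
  classes (all coefficient values) is `A·det₃` for an explicit `A`, e.g.
  `α x₀₀x₀₁x₁₂ + β x₀₀x₀₂x₁₁ + γ x₀₁x₀₂x₁₀ = det [[x₀₀, x₀₁, 0], [0, x₀₁, x₀₂], [γx₁₀, -βx₁₁, αx₁₂]]`.

With `FormDeborderingEndType.formDebordering_of_mem_endOrbit` each of these forms has F1's toric shape
outright (no border hypothesis needed); F1 at (3,3) is thereby reduced, in the kernel up to the
`S₃ × S₃ ⋊ ℤ/2` relabelling and on paper for the last class, to the permutation-monomial family `F_c`
(Disproof §6d: `F_c ∈ GL₉·det₃` iff `c_id c_(123) c_(132) + c_(12)c_(13)c_(23) = 0` on `(ℂ*)⁶`;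
`G₃ = (det₃ + per₃)/2` is not a border point by the LMR dual criterion).  Refuter/theory seat
`val-width-5779-d1` (stmt-ValiantsHypothesis-5779).  VP ≠ VNP is not touched.
-/

open MvPolynomial Finset
open Literature.Computability.AlgebraicComplexity

namespace Summit.ValiantsHypothesis.Cruxes.ToricFixedPoints.Negative

/-- **Determinants of rescaled single variables are End-type.**  If every entry of a square matrix
`N` over `k[X_σ]` is a scalar multiple of one variable, `N i j = s i j • X (v i j)`, then
`det N = A·det_n` for the substitution matrix `A k (i,j) = [k = v i j]·s i j`. [folklore] -/
theorem det_smul_X_mem_endOrbit {n : Type*} [Fintype n] [DecidableEq n] {K : Type*} [Field K]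
    (s : n → n → K) (v : n → n → n × n) :
    (Matrix.of fun i j => s i j • (X (v i j) : MvPolynomial (n × n) K)).det ∈
      endOrbit (n × n) K (detPoly n K) := by
  classical
  refine ⟨Matrix.of fun k p => if k = v p.1 p.2 then s p.1 p.2 else 0, ?_⟩
  show linSubst (n × n) K _ (detPoly n K) = _
  unfold detPoly
  rw [AlgHom.map_det]
  congr 1
  ext i j : 2
  simp only [AlgHom.mapMatrix_apply, Matrix.map_apply, Matrix.mvPolynomialX_apply, linSubst_X,
    Matrix.of_apply, ite_smul, zero_smul, Finset.sum_ite_eq', Finset.mem_univ, if_true]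

/-- Content class `x₀₀³` (margins `(3,0,0) × (3,0,0)`): `α x₀₀³ = det diag(αx₀₀, x₀₀, x₀₀)`. [folklore] -/
theorem contentClass₁_mem_endOrbit (α : ℂ) :
    (α • (X (0, 0) * X (0, 0) * X (0, 0)) : MvPolynomial (Fin 3 × Fin 3) ℂ) ∈
      endOrbit (Fin 3 × Fin 3) ℂ (detPoly (Fin 3) ℂ) := by
  have h := det_smul_X_mem_endOrbit (K := ℂ) ![![α, 0, 0], ![0, 1, 0], ![0, 0, 1]]
    ![![((0 : Fin 3), (0 : Fin 3)), (0, 0), (0, 0)], ![(0, 0), (0, 0), (0, 0)],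
      ![(0, 0), (0, 0), (0, 0)]]
  convert h using 1
  rw [Matrix.det_fin_three]
  simp only [Matrix.of_apply, Matrix.cons_val_zero, Matrix.cons_val_one, Matrix.cons_val,
    smul_eq_C_mul, map_one, map_zero]
  ring

/-- Content class `x₀₀²x₀₁` (margins `(3,0,0) × (2,1,0)`): `α x₀₀²x₀₁ = det diag(αx₀₀, x₀₀, x₀₁)`.
[folklore] -/
theorem contentClass₂_mem_endOrbit (α : ℂ) :
    (α • (X (0, 0) * X (0, 0) * X (0, 1)) : MvPolynomial (Fin 3 × Fin 3) ℂ) ∈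
      endOrbit (Fin 3 × Fin 3) ℂ (detPoly (Fin 3) ℂ) := by
  have h := det_smul_X_mem_endOrbit (K := ℂ) ![![α, 0, 0], ![0, 1, 0], ![0, 0, 1]]
    ![![((0 : Fin 3), (0 : Fin 3)), (0, 0), (0, 0)], ![(0, 0), (0, 0), (0, 0)],
      ![(0, 0), (0, 0), (0, 1)]]
  convert h using 1
  rw [Matrix.det_fin_three]
  simp only [Matrix.of_apply, Matrix.cons_val_zero, Matrix.cons_val_one, Matrix.cons_val,
    smul_eq_C_mul, map_one, map_zero]
  ring

/-- Content class `x₀₀x₀₁x₀₂` (margins `(3,0,0) × (1,1,1)`): `α x₀₀x₀₁x₀₂ = det diag(αx₀₀, x₀₁, x₀₂)`.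
[folklore] -/
theorem contentClass₃_mem_endOrbit (α : ℂ) :
    (α • (X (0, 0) * X (0, 1) * X (0, 2)) : MvPolynomial (Fin 3 × Fin 3) ℂ) ∈
      endOrbit (Fin 3 × Fin 3) ℂ (detPoly (Fin 3) ℂ) := by
  have h := det_smul_X_mem_endOrbit (K := ℂ) ![![α, 0, 0], ![0, 1, 0], ![0, 0, 1]]
    ![![((0 : Fin 3), (0 : Fin 3)), (0, 0), (0, 0)], ![(0, 0), (0, 1), (0, 0)],
      ![(0, 0), (0, 0), (0, 2)]]
  convert h using 1
  rw [Matrix.det_fin_three]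
  simp only [Matrix.of_apply, Matrix.cons_val_zero, Matrix.cons_val_one, Matrix.cons_val,
    smul_eq_C_mul, map_one, map_zero]
  ring

/-- Content class `⟨x₀₀²x₁₁, x₀₀x₀₁x₁₀⟩` (margins `(2,1,0) × (2,1,0)`):
`α x₀₀²x₁₁ + β x₀₀x₀₁x₁₀ = det [[x₀₀, 0, 0], [0, αx₀₀, βx₀₁], [0, -x₁₀, x₁₁]]`. [folklore] -/
theorem contentClass₄_mem_endOrbit (α β : ℂ) :
    (α • (X (0, 0) * X (0, 0) * X (1, 1)) + β • (X (0, 0) * X (0, 1) * X (1, 0)) :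
        MvPolynomial (Fin 3 × Fin 3) ℂ) ∈ endOrbit (Fin 3 × Fin 3) ℂ (detPoly (Fin 3) ℂ) := by
  have h := det_smul_X_mem_endOrbit (K := ℂ) ![![1, 0, 0], ![0, α, β], ![0, -1, 1]]
    ![![((0 : Fin 3), (0 : Fin 3)), (0, 0), (0, 0)], ![(0, 0), (0, 0), (0, 1)],
      ![(0, 0), (1, 0), (1, 1)]]
  convert h using 1
  rw [Matrix.det_fin_three]
  simp only [Matrix.of_apply, Matrix.cons_val_zero, Matrix.cons_val_one, Matrix.cons_val,
    smul_eq_C_mul, map_one, map_zero, map_neg]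
  ring

/-- Content class `⟨x₀₀x₀₁x₁₂, x₀₀x₀₂x₁₁, x₀₁x₀₂x₁₀⟩` (margins `(2,1,0) × (1,1,1)`, the "W-state"
class): `α x₀₀x₀₁x₁₂ + β x₀₀x₀₂x₁₁ + γ x₀₁x₀₂x₁₀ = det [[x₀₀, x₀₁, 0], [0, x₀₁, x₀₂], [γx₁₀, -βx₁₁, αx₁₂]]`
(Disproof §6d's displayed identity). [folklore] -/
theorem contentClass₅_mem_endOrbit (α β γ : ℂ) :
    (α • (X (0, 0) * X (0, 1) * X (1, 2)) + β • (X (0, 0) * X (0, 2) * X (1, 1)) +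
          γ • (X (0, 1) * X (0, 2) * X (1, 0)) : MvPolynomial (Fin 3 × Fin 3) ℂ) ∈
      endOrbit (Fin 3 × Fin 3) ℂ (detPoly (Fin 3) ℂ) := by
  have h := det_smul_X_mem_endOrbit (K := ℂ) ![![1, 1, 0], ![0, 1, 1], ![γ, -β, α]]
    ![![((0 : Fin 3), (0 : Fin 3)), (0, 1), (0, 0)], ![(0, 0), (0, 1), (0, 2)],
      ![(1, 0), (1, 1), (1, 2)]]
  convert h using 1
  rw [Matrix.det_fin_three]
  simp only [Matrix.of_apply, Matrix.cons_val_zero, Matrix.cons_val_one, Matrix.cons_val,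
    smul_eq_C_mul, map_one, map_zero, map_neg]
  ring

end Summit.ValiantsHypothesis.Cruxes.ToricFixedPoints.Negative
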